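import Summits.AtomisticToContinuum.Crystallization.Theorems.ChartedZeroExcessLayeredLatticeLiouvilleZV

/-!
# Part ZX «Re-slicing a constant-letter Barlow graph: six tilting automorphisms of the fcc contact graph» (lens-2 g79, NODE 79 rider 7 = LEMMA E core; imports ZV)

On the all-`c` branch of the window dichotomy (Part ZW, `allC_of_not_capType`) the letters of the target chart are CONSTANT on the layer range met, so its Barlow
graph is, on that slab, the constant-letter graph `BarlowAdj (fun _ ↦ b)` (`barlowAdj_congr`) — the Cayley graph of `ℤ³` on the twelve generators `linkSite b b`
(`barlowAdj_const_iff`; the `A₃` root system in these coordinates, i.e. the fcc contact graph).  Any injective additive self-map of `ℤ³` permuting the twelve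
generators is an automorphism of it (`barlowAdj_of_additive_iff`).  `reslice b f` (`f : Fin 3`) are SIX EXPLICIT unimodular such maps (with explicit inverses
`resliceInv b f`): re-indexing a constant-letter Barlow chart `Ψ` as `Ψ ∘ reslice b f` (new index `y` ↦ old index `reslice b f y`) gives a Barlow chart with the
same letter (`isBarlowBondChart_reslice`, from `barlowAdj_reslice_iff`) whose NEW sheet `k` consists of the old indices `z` with `(resliceInv b f z).1 = k`
(`reslice_reindex_apply`) — by `resliceInv_fst` the level-`k` set of the covector `u₁`, `u₂`, `k + u₁ + u₂` (letter `true`, `f = 0, 1, 2`) resp. `u₁`,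
`u₂`, `-k + u₁ + u₂` (letter `false`): the three close-packed plane families of the constant-letter (fcc) graph OTHER than the old sheets `{k = const}`
(`reslice_tilts`: new sheet `0` contains an old index off old sheet `0`; `reslice_sheet_census`: of the twelve neighbours of a site, exactly 6 / 3 / 3 lie on
its new sheet / the next / the previous one — the Barlow sheet structure in the new slicing).  [Enumeration `dev/zx/reslice_search.py`: the constant-letter
graph has exactly 48 linear automorphisms (`O_h`), 36 of them tilting the sheet plane, and all three tilted families are reached, for both letters.]
Pure combinatorics (`decide` over `Bool × Fin 3 × Fin 12`, `rfl`/`simp`/`omega` for the six integer matrices); 0 sorry.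
-/

open Summit.AtomisticToContinuum.Crystallization.Theorems.ChartedPlanarOrderRigidityDoor (E3)

namespace Summit.AtomisticToContinuum.Crystallization.Theorems.ChartedZeroExcessLayeredLatticeLiouville

/-! ## ZX-1  Constant letters: the Cayley graph on the twelve generators -/

/-- `BarlowAdj τ p q` reads `τ` only at `p.1` and `q.1`. [formal bookkeeping] -/
theorem barlowAdj_congr {τ τ'' : ℤ → Bool} {p q : ℤ × ℤ × ℤ} (h₁ : τ p.1 = τ'' p.1) (h₂ : τ q.1 = τ'' q.1) :
    BarlowAdj τ p q ↔ BarlowAdj τ'' p q := by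
  simp only [BarlowAdj, h₁, h₂]

/-- on a slab where the letters are constant, the Barlow graph is the constant-letter graph. [formal bookkeeping] -/
theorem barlowAdj_slab_iff {τ : ℤ → Bool} {b : Bool} {m₁ m₂ : ℤ} (hτ : ∀ m, m₁ ≤ m → m ≤ m₂ → τ m = b) {p q : ℤ × ℤ × ℤ}
    (hp : m₁ ≤ p.1) (hp' : p.1 ≤ m₂) (hq : m₁ ≤ q.1) (hq' : q.1 ≤ m₂) : BarlowAdj τ p q ↔ BarlowAdj (fun _ => b) p q :=
  barlowAdj_congr (hτ _ hp hp') (hτ _ hq hq')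

/-- a bond chart whose letters are constant `= b` on the layers its domain meets is a bond chart for the constant letter `b`. [formal bookkeeping] -/
theorem isBarlowBondChart_constLetter {C : Set E3} {D : Set (ℤ × ℤ × ℤ)} {Ψ : ℤ × ℤ × ℤ → E3} {τ : ℤ → Bool} {b : Bool}
    (hτ : ∀ y ∈ D, τ y.1 = b) (h : IsBarlowBondChart C D Ψ τ) : IsBarlowBondChart C D Ψ (fun _ => b) :=
  ⟨h.1, h.2.1, fun y hy y' hy' => (h.2.2 y hy y' hy').trans (barlowAdj_congr (hτ y hy) (hτ y' hy'))⟩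

/-- ★ the constant-letter Barlow graph is the Cayley graph of `ℤ³` on the twelve generators `linkSite b b`. [this file, g79] -/
theorem barlowAdj_const_iff (b : Bool) (p q : ℤ × ℤ × ℤ) : BarlowAdj (fun _ => b) p q ↔ ∃ i : Fin 12, q = p + linkSite b b i := by
  constructor
  · intro h
    obtain ⟨i, hi⟩ := exists_code_of_barlowAdj h
    exact ⟨i, hi⟩
  · rintro ⟨i, rfl⟩
    exact barlowAdj_linkPt (fun _ => b) p i

/-- ★ TRANSPORT: an injective additive self-map of `ℤ³` permuting the twelve generators is an automorphism of the constant-letter graph. [this file, g79] -/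
theorem barlowAdj_of_additive_iff {b : Bool} {φ : ℤ × ℤ × ℤ → ℤ × ℤ × ℤ} (hadd : ∀ p n, φ (p + n) = φ p + φ n) (hinj : Function.Injective φ)
    (hfw : ∀ i : Fin 12, ∃ j : Fin 12, φ (linkSite b b i) = linkSite b b j) (hbw : ∀ j : Fin 12, ∃ i : Fin 12, φ (linkSite b b i) = linkSite b b j)
    (p q : ℤ × ℤ × ℤ) : BarlowAdj (fun _ => b) (φ p) (φ q) ↔ BarlowAdj (fun _ => b) p q := by
  rw [barlowAdj_const_iff, barlowAdj_const_iff]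
  constructor
  · rintro ⟨j, hj⟩
    obtain ⟨i, hi⟩ := hbw j
    refine ⟨i, hinj ?_⟩
    rw [hadd, hi]
    exact hj
  · rintro ⟨i, rfl⟩
    obtain ⟨j, hj⟩ := hfw i
    exact ⟨j, by rw [hadd, hj]⟩

/-! ## ZX-2  The six tilting automorphisms and their inverses (explicit, unimodular) -/

/-- `reslice b f`: for letter `b`, a unimodular self-map of `ℤ³` (sheet coordinates `(k; u₁, u₂)`) permuting the twelve generators `linkSite b b`; used as the
re-indexing `new index ↦ old index`, it makes the new sheets the tilted family `f` (see `resliceInv_fst`; found by `dev/zx/reslice_search.py`). [this file, g79] -/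
def reslice : Bool → Fin 3 → ℤ × ℤ × ℤ → ℤ × ℤ × ℤ
  | true, 0, (k, u₁, u₂) => (u₂, k, u₁)
  | true, 1, (k, u₁, u₂) => (u₂, u₁, k)
  | true, 2, (k, u₁, u₂) => (-u₂, k + u₁ + u₂, -u₁)
  | false, 0, (k, u₁, u₂) => (u₂, k, -u₁)
  | false, 1, (k, u₁, u₂) => (u₂, -u₁, k)
  | false, 2, (k, u₁, u₂) => (-u₂, k - u₁ - u₂, u₁)

/-- the inverse maps. [this file, g79] -/
def resliceInv : Bool → Fin 3 → ℤ × ℤ × ℤ → ℤ × ℤ × ℤ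
  | true, 0, (x, y, z) => (y, z, x)
  | true, 1, (x, y, z) => (z, y, x)
  | true, 2, (x, y, z) => (x + y + z, -z, -x)
  | false, 0, (x, y, z) => (y, -z, x)
  | false, 1, (x, y, z) => (z, -y, x)
  | false, 2, (x, y, z) => (-x + y + z, z, -x)

/-- [formal bookkeeping] -/
theorem resliceInv_reslice (b : Bool) (f : Fin 3) (p : ℤ × ℤ × ℤ) : resliceInv b f (reslice b f p) = p := by
  obtain ⟨k, u₁, u₂⟩ := p
  have hf : f = 0 ∨ f = 1 ∨ f = 2 := by revert f; decide
  rcases hf with rfl | rfl | rfl <;> cases b <;> simp [reslice, resliceInv]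

/-- [formal bookkeeping] -/
theorem reslice_resliceInv (b : Bool) (f : Fin 3) (p : ℤ × ℤ × ℤ) : reslice b f (resliceInv b f p) = p := by
  obtain ⟨x, y, z⟩ := p
  have hf : f = 0 ∨ f = 1 ∨ f = 2 := by revert f; decide
  rcases hf with rfl | rfl | rfl <;> cases b <;> simp [reslice, resliceInv]

/-- [formal bookkeeping] -/
theorem reslice_injective (b : Bool) (f : Fin 3) : Function.Injective (reslice b f) :=
  Function.LeftInverse.injective (resliceInv_reslice b f)

/-- [formal bookkeeping] -/
theorem resliceInv_injective (b : Bool) (f : Fin 3) : Function.Injective (resliceInv b f) :=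
  Function.LeftInverse.injective (reslice_resliceInv b f)

/-- [formal bookkeeping] -/
theorem reslice_add (b : Bool) (f : Fin 3) (p n : ℤ × ℤ × ℤ) : reslice b f (p + n) = reslice b f p + reslice b f n := by
  obtain ⟨k, u₁, u₂⟩ := p
  obtain ⟨k', u₁', u₂'⟩ := n
  have hf : f = 0 ∨ f = 1 ∨ f = 2 := by revert f; decide
  rcases hf with rfl | rfl | rfl <;> cases b <;> first | rfl | (simp only [reslice, Prod.mk_add_mk, Prod.mk.injEq, true_and, and_true]; omega)

/-- [formal bookkeeping] -/
theorem resliceInv_add (b : Bool) (f : Fin 3) (p n : ℤ × ℤ × ℤ) : resliceInv b f (p + n) = resliceInv b f p + resliceInv b f n := by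
  obtain ⟨x, y, z⟩ := p
  obtain ⟨x', y', z'⟩ := n
  have hf : f = 0 ∨ f = 1 ∨ f = 2 := by revert f; decide
  rcases hf with rfl | rfl | rfl <;> cases b <;> first | rfl | (simp only [resliceInv, Prod.mk_add_mk, Prod.mk.injEq, true_and, and_true]; omega)

/-- the six maps permute the twelve generators (finite). [formal bookkeeping] -/
theorem reslice_linkSite (b : Bool) (f : Fin 3) (i : Fin 12) : ∃ j : Fin 12, reslice b f (linkSite b b i) = linkSite b b j := by
  revert b f i; decide

/-- … surjectively (finite). [formal bookkeeping] -/
theorem reslice_linkSite_surj (b : Bool) (f : Fin 3) (j : Fin 12) : ∃ i : Fin 12, reslice b f (linkSite b b i) = linkSite b b j := by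
  revert b f j; decide

/-- the inverses permute the generators too (finite). [formal bookkeeping] -/
theorem resliceInv_linkSite (b : Bool) (f : Fin 3) (i : Fin 12) : ∃ j : Fin 12, resliceInv b f (linkSite b b i) = linkSite b b j := by
  revert b f i; decide

/-- [formal bookkeeping] -/
theorem resliceInv_linkSite_surj (b : Bool) (f : Fin 3) (j : Fin 12) : ∃ i : Fin 12, resliceInv b f (linkSite b b i) = linkSite b b j := by
  revert b f j; decide

/-- ★ the six re-indexings TILT the sheets: new sheet `0` (the old indices `reslice b f y`, `y.1 = 0`) contains an old index OFF old sheet `0`, namely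
`reslice b f (0; 1, 0)` or `reslice b f (0; 0, 1)`. [this file, g79] -/
theorem reslice_tilts (b : Bool) (f : Fin 3) : (reslice b f (0, 1, 0)).1 ≠ 0 ∨ (reslice b f (0, 0, 1)).1 ≠ 0 := by
  revert b f; decide

/-- ★ the NEW SHEET INDEX of an old index `z = (k; u₁, u₂)` under the re-indexing `f`: the covectors `u₁ ∣ u₂ ∣ k + u₁ + u₂` (letter `true`) and
`u₁ ∣ u₂ ∣ -k + u₁ + u₂` (letter `false`) — three pairwise non-proportional covectors, none proportional to the old sheet index `k`. [this file, g79] -/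
theorem resliceInv_fst (z : ℤ × ℤ × ℤ) :
    (resliceInv true 0 z).1 = z.2.1 ∧ (resliceInv true 1 z).1 = z.2.2 ∧ (resliceInv true 2 z).1 = z.1 + z.2.1 + z.2.2 ∧
      (resliceInv false 0 z).1 = z.2.1 ∧ (resliceInv false 1 z).1 = z.2.2 ∧ (resliceInv false 2 z).1 = -z.1 + z.2.1 + z.2.2 := by
  obtain ⟨x, y, w⟩ := z
  exact ⟨rfl, rfl, rfl, rfl, rfl, rfl⟩

/-- ★ SHEET CENSUS in the new slicing (finite certificate that the new sheets are close-packed planes stacked Barlow-wise): of the twelve generators, exactly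
six have new sheet index `0`, three have `+1` and three have `-1`. [this file, g79] -/
theorem reslice_sheet_census (b : Bool) (f : Fin 3) :
    (Finset.univ.filter fun i : Fin 12 => (resliceInv b f (linkSite b b i)).1 = 0).card = 6 ∧
      (Finset.univ.filter fun i : Fin 12 => (resliceInv b f (linkSite b b i)).1 = 1).card = 3 ∧
        (Finset.univ.filter fun i : Fin 12 => (resliceInv b f (linkSite b b i)).1 = -1).card = 3 := by
  revert b f; decide

/-! ## ZX-3  ★ Re-slicing preserves and reflects adjacency -/

/-- ★★ `reslice b f` is an automorphism of the constant-letter Barlow graph. [this file, g79] -/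
theorem barlowAdj_reslice_iff (b : Bool) (f : Fin 3) (p q : ℤ × ℤ × ℤ) :
    BarlowAdj (fun _ => b) (reslice b f p) (reslice b f q) ↔ BarlowAdj (fun _ => b) p q :=
  barlowAdj_of_additive_iff (reslice_add b f) (reslice_injective b f) (reslice_linkSite b f) (reslice_linkSite_surj b f) p q

/-- ★★ so is its inverse — the form used to re-index a chart: `Ψ ∘ resliceInv b f` is a Barlow chart with the same constant letter whose sheet `{y.1 = k}` is
the tilted plane `resliceInv b f '' {y.1 = k}` of the old indexing. [this file, g79] -/
theorem barlowAdj_resliceInv_iff (b : Bool) (f : Fin 3) (p q : ℤ × ℤ × ℤ) :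
    BarlowAdj (fun _ => b) (resliceInv b f p) (resliceInv b f q) ↔ BarlowAdj (fun _ => b) p q :=
  barlowAdj_of_additive_iff (resliceInv_add b f) (resliceInv_injective b f) (resliceInv_linkSite b f) (resliceInv_linkSite_surj b f) p q

/-- ★ RE-INDEXED CHART: if `Ψ` is a bond chart of `C` on `D` for the constant letter `b` (injective on `D`, into `C`, bonds ↔ constant-letter adjacency), then so
is `Ψ ∘ reslice b f` (new index `y` ↦ old index `reslice b f y`) on the re-indexed domain. [this file, g79] -/
theorem isBarlowBondChart_reslice {C : Set E3} {D : Set (ℤ × ℤ × ℤ)} {Ψ : ℤ × ℤ × ℤ → E3} (b : Bool) (f : Fin 3)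
    (h : IsBarlowBondChart C D Ψ (fun _ => b)) : IsBarlowBondChart C {y | reslice b f y ∈ D} (Ψ ∘ reslice b f) (fun _ => b) := by
  obtain ⟨hinj, hmaps, hbond⟩ := h
  refine ⟨fun y hy y' hy' e => reslice_injective b f (hinj hy hy' e), fun y hy => hmaps hy, fun y hy y' hy' => ?_⟩
  rw [Function.comp_apply, Function.comp_apply, hbond _ hy _ hy', barlowAdj_reslice_iff]

/-- … the old index `z` becomes the new index `resliceInv b f z` of the same atom … [formal bookkeeping] -/
theorem reslice_reindex_apply (Ψ : ℤ × ℤ × ℤ → E3) (b : Bool) (f : Fin 3) (z : ℤ × ℤ × ℤ) : (Ψ ∘ reslice b f) (resliceInv b f z) = Ψ z := by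
  rw [Function.comp_apply, reslice_resliceInv]

/-- … so the re-indexed chart still covers what `Ψ` covered. [formal bookkeeping] -/
theorem covers_reslice {C : Set E3} {Ψ : ℤ × ℤ × ℤ → E3} (b : Bool) (f : Fin 3) (h : ∀ c ∈ C, ∃ z, Ψ z = c) :
    ∀ c ∈ C, ∃ y, (Ψ ∘ reslice b f) y = c := fun c hc => by
  obtain ⟨z, hz⟩ := h c hc
  exact ⟨resliceInv b f z, by rw [reslice_reindex_apply, hz]⟩

end Summit.AtomisticToContinuum.Crystallization.Theorems.ChartedZeroExcessLayeredLatticeLiouville
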